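import Mathlib.Analysis.Calculus.Deriv.MeanValue
import Summits.SmoothPoincare4.SmoothPoincare4.Theorems.DottedCircleRasmussenDcrGapHelperFriendsCarrierVkPartAFrameTube
import Summits.SmoothPoincare4.SmoothPoincare4.Theorems.DottedCircleRasmussenDcrGapHelperFriendsCarrierVkPartAPushHomotopy
import Summits.SmoothPoincare4.SmoothPoincare4.Theorems.DottedCircleRasmussenDcrGapHelperFriendsCarrierVkPartABoundaryFrame
import Summits.SmoothPoincare4.SmoothPoincare4.Theorems.DottedCircleRasmussenDcrGapHelperFriendsCarrierVkDiscFlowLinesNeat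

/-!
# Helper `helper_friendsCarrier_Vk_partA_tubeFrameInverse` (piece 8a of the registered stub
`helper_friendsCarrier_Vk_partA`, line `mk_friends`, skeleton v8) for crux `DcrGap`
(item stmt-SmoothPoincare4-16128, route route-SmoothPoincare4-DottedCircleRasmussen)

**Preliminaries for the reduction of the framing input of Part A to its push-off form**
(`…VkPartAInputOfPush`): (1) just outside the boundary circle a neat model slice disc dips into `D_k°`
(`exists_collar_level_lt`: the level `G_k ∘ f₁` strictly decreases along the rays, by `exists_neatZone` and the
mean value theorem); (2) a push-off `νK(u, w)` of the model knot inside `M_k` which is a point `f₁ x` of the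
enlarged disc is a knot point (`eq_of_apply_eq_disc`: the open disc misses `D_k`, the collar has level `< 1`,
and `νK` is injective); (3) small push-offs lie in any open set containing the knot (`exists_pushOff_mem`,
compactness of the circle); (4) along the zero section of the affine tube `F(x, w) = f₁ x + w₀ m₀ x + w₁ m₁ x`
with `C^∞` left inverse `Finv` one has `DFinv ∘ DF = 1`, so the fibre part of `DFinv (df₁ e + α m₀ + β m₁)` is
`(α, β)` (`fderiv_inv_apply_frame`, the registered statement of this file).

No definitions, no named facts, no `sorry`.

## References

* M. W. Hirsch, *Differential Topology*, GTM 33 (1976), Ch. 4 §5, §6. [Hirsch1976]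
-/

-- the prescribed namespace `Summit.<P>.<Sub>.…` duplicates `SmoothPoincare4` (P = Sub)
set_option linter.dupNamespace false
set_option linter.style.longLine false

noncomputable section

open scoped Manifold ContDiff Topology
open Set Function Metric Filter
open Literature.Topology.FourManifolds Literature.Topology.FourManifolds.MMSW

namespace Summit.SmoothPoincare4.SmoothPoincare4.Theorems.DcrGap.MkFriends

namespace FriendsCarrierVk

variable {k : ℕ} {K₁ : (sphere (0 : EuclideanSpace ℝ (Fin 2)) 1) → EuclideanSpace ℝ (Fin 4)}
  {f₁ : EuclideanSpace ℝ (Fin 2) → EuclideanSpace ℝ (Fin 4)}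
  {νK : (sphere (0 : EuclideanSpace ℝ (Fin 2)) 1) × EuclideanSpace ℝ (Fin 2) → EuclideanSpace ℝ (Fin 4)}

/-! ## The collar of a neat disc dips into `D_k°` -/

/-- **Just outside the circle the level of a neat model slice disc is `< 1`.** [folklore] -/
theorem exists_collar_level_lt (hK : IsModelKnot k K₁) (hf : IsModelSliceDisc k K₁ f₁)
    (hneat : ∀ t : (sphere (0 : EuclideanSpace ℝ (Fin 2)) 1), deriv (fun ρ : ℝ => levelFun k (f₁ (ρ • (t : EuclideanSpace ℝ (Fin 2))))) 1 < 0) :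
    ∃ δc : ℝ, 0 < δc ∧ ∀ (u : (sphere (0 : EuclideanSpace ℝ (Fin 2)) 1)) (ρ : ℝ), 1 < ρ → ρ ≤ 1 + δc →
      levelFun k (f₁ (ρ • (u : EuclideanSpace ℝ (Fin 2)))) < 1 := by
  obtain ⟨δ₂, hδ₂, -, hzone⟩ := exists_neatZone k hK hf hneat
  have hfs : ContDiff ℝ ∞ f₁ := contMDiff_iff_contDiff.1 hf.1
  refine ⟨δ₂ / 2, by linarith, fun u ρ hρ1 hρ2 => ?_⟩
  set g : ℝ → ℝ := fun ρ => levelFun k (f₁ (ρ • (u : EuclideanSpace ℝ (Fin 2)))) with hg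
  have hu1 : ‖(u : EuclideanSpace ℝ (Fin 2))‖ = 1 := norm_eq_of_mem_sphere u
  -- differentiability and negative derivative on `[1, 1 + δ₂/2]`
  have hderiv : ∀ ρ ∈ Icc (1 : ℝ) (1 + δ₂ / 2), HasDerivAt g
      (fderiv ℝ (fun y => levelFun k (f₁ y)) (ρ • (u : EuclideanSpace ℝ (Fin 2))) (u : EuclideanSpace ℝ (Fin 2))) ρ ∧
      fderiv ℝ (fun y => levelFun k (f₁ y)) (ρ • (u : EuclideanSpace ℝ (Fin 2))) (u : EuclideanSpace ℝ (Fin 2)) < 0 := by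
    intro ρ hρ
    have hρpos : 0 < ρ := by linarith [hρ.1]
    have hx : |‖ρ • (u : EuclideanSpace ℝ (Fin 2))‖ - 1| < δ₂ := by
      rw [norm_smul, hu1, mul_one, Real.norm_of_nonneg hρpos.le]
      rw [abs_lt]; constructor <;> linarith [hρ.1, hρ.2]
    obtain ⟨hguard, hneg⟩ := hzone _ hx
    have hunit : ‖ρ • (u : EuclideanSpace ℝ (Fin 2))‖⁻¹ • (ρ • (u : EuclideanSpace ℝ (Fin 2))) = (u : EuclideanSpace ℝ (Fin 2)) := by
      rw [norm_smul, hu1, mul_one, Real.norm_of_nonneg hρpos.le, smul_smul, inv_mul_cancel₀ hρpos.ne', one_smul]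
    rw [hunit] at hneg
    have hGd : DifferentiableAt ℝ (levelFun k) (f₁ (ρ • (u : EuclideanSpace ℝ (Fin 2)))) :=
      (contDiffAt_levelFun fun j => (one_half_pos.trans (hguard j)).ne').differentiableAt (by simp)
    have hcomp : DifferentiableAt ℝ (fun y => levelFun k (f₁ y)) (ρ • (u : EuclideanSpace ℝ (Fin 2))) :=
      hGd.comp _ ((hfs.differentiable (by simp)) _)
    have hline : HasDerivAt (fun ρ' : ℝ => ρ' • (u : EuclideanSpace ℝ (Fin 2))) (u : EuclideanSpace ℝ (Fin 2)) ρ := by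
      simpa using (hasDerivAt_id ρ).smul_const (u : EuclideanSpace ℝ (Fin 2))
    have hchain := hcomp.hasFDerivAt.comp_hasDerivAt ρ hline
    exact ⟨hchain, hneg⟩
  have hanti : StrictAntiOn g (Icc (1 : ℝ) (1 + δ₂ / 2)) := by
    refine strictAntiOn_of_deriv_neg (convex_Icc _ _) (fun ρ hρ => (hderiv ρ hρ).1.continuousAt.continuousWithinAt) ?_
    intro ρ hρ
    rw [interior_Icc] at hρ
    rw [(hderiv ρ ⟨hρ.1.le, hρ.2.le⟩).1.deriv]
    exact (hderiv ρ ⟨hρ.1.le, hρ.2.le⟩).2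
  have h1 : g 1 = 1 := by
    simp only [hg, one_smul]
    rw [hf.2.2.2.2 u]
    exact (hK.2.2.2 u).2
  have := hanti ⟨le_rfl, by linarith⟩ ⟨hρ1.le, hρ2⟩ hρ1
  rw [h1] at this
  exact this

/-! ## Points of `M_k` on the zero section of the tube are knot points -/

/-- **A push-off never returns to the zero section.**  If `νK(u, w₁) = f₁ x` with `‖x‖ < 1 + δc` (collar
inside `D_k°`), then `x` is on the circle and `(u, w₁) = (x, 0)`. [folklore] -/
theorem eq_of_apply_eq_disc (hf : IsModelSliceDisc k K₁ f₁) (hνinj : Injective νK) (hνM : ∀ p, νK p ∈ modelBoundary k)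
    (hν0 : ∀ u : (sphere (0 : EuclideanSpace ℝ (Fin 2)) 1), νK (u, 0) = K₁ u) {δc : ℝ}
    (hcol : ∀ (u : (sphere (0 : EuclideanSpace ℝ (Fin 2)) 1)) (ρ : ℝ), 1 < ρ → ρ ≤ 1 + δc → levelFun k (f₁ (ρ • (u : EuclideanSpace ℝ (Fin 2)))) < 1)
    {u : (sphere (0 : EuclideanSpace ℝ (Fin 2)) 1)} {w₁ x : EuclideanSpace ℝ (Fin 2)} (hx : ‖x‖ < 1 + δc)
    (h : νK (u, w₁) = f₁ x) : w₁ = 0 := by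
  have hmem : f₁ x ∈ modelBoundary k := h ▸ hνM _
  -- `x` is not inside the disc
  have hx1 : 1 ≤ ‖x‖ := by
    by_contra hlt
    exact hf.2.2.2.1 x (not_le.1 hlt) (modelBoundary_subset_modelHandlebody hmem)
  -- `x` is not in the collar
  have hx2 : ‖x‖ ≤ 1 := by
    by_contra hgt
    set u' : (sphere (0 : EuclideanSpace ℝ (Fin 2)) 1) := radialProjection u x with hu'
    have hxu : x = ‖x‖ • (u' : EuclideanSpace ℝ (Fin 2)) := (norm_smul_coe_radialProjection u x).symm
    have := hcol u' ‖x‖ (not_le.1 hgt) hx.le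
    rw [← hxu, hmem.2] at this
    exact lt_irrefl _ this
  -- so `x` is on the circle, where the disc is the knot
  have hxn : ‖x‖ = 1 := le_antisymm hx2 hx1
  let x' : (sphere (0 : EuclideanSpace ℝ (Fin 2)) 1) := ⟨x, by simpa using hxn⟩
  have h' : νK (u, w₁) = νK (x', 0) := by rw [h, hν0 x', ← hf.2.2.2.2 x']
  exact congrArg Prod.snd (hνinj h')

/-! ## Push-offs enter the tube -/

/-- **Small push-offs of the knot lie in any open set containing the knot.** [folklore] -/
theorem exists_pushOff_mem (hνc : Continuous νK) (hν0 : ∀ u : (sphere (0 : EuclideanSpace ℝ (Fin 2)) 1), νK (u, 0) = K₁ u)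
    {T : Set (EuclideanSpace ℝ (Fin 4))} (hT : IsOpen T) (hKT : ∀ u : (sphere (0 : EuclideanSpace ℝ (Fin 2)) 1), K₁ u ∈ T) :
    ∃ s : ℝ, 0 < s ∧ ∀ (u : (sphere (0 : EuclideanSpace ℝ (Fin 2)) 1)) (w : EuclideanSpace ℝ (Fin 2)), ‖w‖ ≤ s → νK (u, w) ∈ T := by
  have hU : IsOpen (νK ⁻¹' T) := hT.preimage hνc
  have hKc : IsCompact ((univ : Set (sphere (0 : EuclideanSpace ℝ (Fin 2)) 1)) ×ˢ ({0} : Set (EuclideanSpace ℝ (Fin 2)))) :=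
    isCompact_univ.prod isCompact_singleton
  have hsub : (univ : Set (sphere (0 : EuclideanSpace ℝ (Fin 2)) 1)) ×ˢ ({0} : Set (EuclideanSpace ℝ (Fin 2))) ⊆ νK ⁻¹' T := by
    rintro ⟨u, w⟩ ⟨-, hw⟩
    rw [mem_singleton_iff] at hw
    subst hw
    show νK (u, 0) ∈ T
    rw [hν0]; exact hKT u
  obtain ⟨ε, hε, hthick⟩ := hKc.exists_thickening_subset_open hU hsub
  refine ⟨ε / 2, by linarith, fun u w hw => hthick ?_⟩
  refine Metric.mem_thickening_iff.2 ⟨(u, 0), ⟨mem_univ _, rfl⟩, ?_⟩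
  rw [Prod.dist_eq, dist_self, dist_zero_right]
  exact max_lt_iff.2 ⟨hε, by linarith⟩

/-! ## The derivative of the fibre coordinates of the push-off -/

/-- **`DFinv ∘ DF = 1` along the zero section**, in the form: the `Finv`-image of a vector decomposed in the
tube frame has the prescribed fibre part. [folklore] -/
theorem fderiv_inv_apply_frame {m₀ m₁ : EuclideanSpace ℝ (Fin 2) → EuclideanSpace ℝ (Fin 4)}
    {Finv : EuclideanSpace ℝ (Fin 4) → EuclideanSpace ℝ (Fin 2) × EuclideanSpace ℝ (Fin 2)} {δ η : ℝ} (hη : 0 < η)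
    (hfs : ContDiff ℝ ∞ f₁) (hm₀ : ContDiff ℝ ∞ m₀) (hm₁ : ContDiff ℝ ∞ m₁)
    (hopen : IsOpen ((fun q : EuclideanSpace ℝ (Fin 2) × EuclideanSpace ℝ (Fin 2) => f₁ q.1 + q.2 0 • m₀ q.1 + q.2 1 • m₁ q.1) ''
        (ball (0 : EuclideanSpace ℝ (Fin 2)) (1 + δ) ×ˢ ball (0 : EuclideanSpace ℝ (Fin 2)) η)))
    (hFinvs : ContDiffOn ℝ ∞ Finv ((fun q : EuclideanSpace ℝ (Fin 2) × EuclideanSpace ℝ (Fin 2) => f₁ q.1 + q.2 0 • m₀ q.1 + q.2 1 • m₁ q.1) ''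
        (ball (0 : EuclideanSpace ℝ (Fin 2)) (1 + δ) ×ˢ ball (0 : EuclideanSpace ℝ (Fin 2)) η)))
    (hleft : ∀ q ∈ ball (0 : EuclideanSpace ℝ (Fin 2)) (1 + δ) ×ˢ ball (0 : EuclideanSpace ℝ (Fin 2)) η,
        Finv (f₁ q.1 + q.2 0 • m₀ q.1 + q.2 1 • m₁ q.1) = q)
    {x : EuclideanSpace ℝ (Fin 2)} (hx : x ∈ ball (0 : EuclideanSpace ℝ (Fin 2)) (1 + δ)) (e : EuclideanSpace ℝ (Fin 2)) (α β : ℝ) :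
    (fderiv ℝ Finv (f₁ x) (fderiv ℝ f₁ x e + α • m₀ x + β • m₁ x)).2 = !₂[α, β] := by
  set F : EuclideanSpace ℝ (Fin 2) × EuclideanSpace ℝ (Fin 2) → EuclideanSpace ℝ (Fin 4) :=
    fun q => f₁ q.1 + q.2 0 • m₀ q.1 + q.2 1 • m₁ q.1 with hFdef
  have hcoord : ∀ i : Fin 2, ContDiff ℝ ∞ fun q : EuclideanSpace ℝ (Fin 2) × EuclideanSpace ℝ (Fin 2) => q.2 i :=
    fun i => by fun_prop
  have hFs : ContDiff ℝ ∞ F :=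
    ((hfs.comp contDiff_fst).add ((hcoord 0).smul (hm₀.comp contDiff_fst))).add ((hcoord 1).smul (hm₁.comp contDiff_fst))
  -- the derivative of `F` at `(x, 0)`
  set L₀ : EuclideanSpace ℝ (Fin 2) × EuclideanSpace ℝ (Fin 2) →L[ℝ] EuclideanSpace ℝ (Fin 4) :=
    (fderiv ℝ f₁ x).comp (ContinuousLinearMap.fst ℝ (EuclideanSpace ℝ (Fin 2)) (EuclideanSpace ℝ (Fin 2))) +
      ((EuclideanSpace.proj (𝕜 := ℝ) (0 : Fin 2)).comp
        (ContinuousLinearMap.snd ℝ (EuclideanSpace ℝ (Fin 2)) (EuclideanSpace ℝ (Fin 2)))).smulRight (m₀ x) +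
      ((EuclideanSpace.proj (𝕜 := ℝ) (1 : Fin 2)).comp
        (ContinuousLinearMap.snd ℝ (EuclideanSpace ℝ (Fin 2)) (EuclideanSpace ℝ (Fin 2)))).smulRight (m₁ x) with hL₀def
  have hL₀apply : ∀ (v a : EuclideanSpace ℝ (Fin 2)), L₀ (v, a) = fderiv ℝ f₁ x v + a 0 • m₀ x + a 1 • m₁ x := by
    intro v a; simp [hL₀def]
  have hderiv0 : HasFDerivAt F L₀ (x, 0) := by
    have hf' : HasFDerivAt (fun q : EuclideanSpace ℝ (Fin 2) × EuclideanSpace ℝ (Fin 2) => f₁ q.1)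
        ((fderiv ℝ f₁ x).comp (ContinuousLinearMap.fst ℝ (EuclideanSpace ℝ (Fin 2)) (EuclideanSpace ℝ (Fin 2)))) (x, 0) :=
      ((hfs.differentiable (by simp)) x).hasFDerivAt.comp (x, 0) hasFDerivAt_fst
    have hni : ∀ (i : Fin 2) (mi : EuclideanSpace ℝ (Fin 2) → EuclideanSpace ℝ (Fin 4)), ContDiff ℝ ∞ mi →
        HasFDerivAt (fun q : EuclideanSpace ℝ (Fin 2) × EuclideanSpace ℝ (Fin 2) => q.2 i • mi q.1)
        (((EuclideanSpace.proj (𝕜 := ℝ) i).comp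
          (ContinuousLinearMap.snd ℝ (EuclideanSpace ℝ (Fin 2)) (EuclideanSpace ℝ (Fin 2)))).smulRight (mi x)) (x, 0) := by
      intro i mi hmi
      have hc : HasFDerivAt (fun q : EuclideanSpace ℝ (Fin 2) × EuclideanSpace ℝ (Fin 2) => q.2 i)
          ((EuclideanSpace.proj (𝕜 := ℝ) i).comp
            (ContinuousLinearMap.snd ℝ (EuclideanSpace ℝ (Fin 2)) (EuclideanSpace ℝ (Fin 2)))) (x, 0) :=
        ((EuclideanSpace.proj (𝕜 := ℝ) i).hasFDerivAt).comp (x, 0) hasFDerivAt_snd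
      have hnd : HasFDerivAt (fun q : EuclideanSpace ℝ (Fin 2) × EuclideanSpace ℝ (Fin 2) => mi q.1)
          ((fderiv ℝ mi x).comp (ContinuousLinearMap.fst ℝ (EuclideanSpace ℝ (Fin 2)) (EuclideanSpace ℝ (Fin 2)))) (x, 0) :=
        ((hmi.differentiable (by simp)) x).hasFDerivAt.comp (x, 0) hasFDerivAt_fst
      refine (hc.fun_smul hnd).congr_fderiv ?_
      simp
    have h := (hf'.fun_add (hni 0 m₀ hm₀)).fun_add (hni 1 m₁ hm₁)
    rw [hFdef]
    exact h
  -- `DFinv ∘ DF = 1` at `(x, 0)`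
  have hq0 : ((x, (0 : EuclideanSpace ℝ (Fin 2))) : EuclideanSpace ℝ (Fin 2) × EuclideanSpace ℝ (Fin 2)) ∈
      ball (0 : EuclideanSpace ℝ (Fin 2)) (1 + δ) ×ˢ ball (0 : EuclideanSpace ℝ (Fin 2)) η := ⟨hx, by simpa using hη⟩
  have hmemT : F (x, 0) ∈ F '' (ball (0 : EuclideanSpace ℝ (Fin 2)) (1 + δ) ×ˢ ball (0 : EuclideanSpace ℝ (Fin 2)) η) := ⟨_, hq0, rfl⟩
  have hFinvd : HasFDerivAt Finv (fderiv ℝ Finv (F (x, 0))) (F (x, 0)) :=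
    ((hFinvs.contDiffAt (hopen.mem_nhds hmemT)).differentiableAt (by simp)).hasFDerivAt
  have hcomp : HasFDerivAt (Finv ∘ F) ((fderiv ℝ Finv (F (x, 0))).comp L₀) (x, 0) := hFinvd.comp (x, 0) hderiv0
  have hid : HasFDerivAt (Finv ∘ F) (ContinuousLinearMap.id ℝ _) (x, 0) := by
    have hev : (Finv ∘ F) =ᶠ[𝓝 (x, 0)] id := by
      filter_upwards [(isOpen_ball.prod isOpen_ball).mem_nhds hq0] with q hq
      exact hleft q hq
    exact (hasFDerivAt_id (𝕜 := ℝ) ((x, (0 : EuclideanSpace ℝ (Fin 2))) : EuclideanSpace ℝ (Fin 2) × EuclideanSpace ℝ (Fin 2))).congr_of_eventuallyEq hev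
  have hEq := hcomp.unique hid
  have hF0 : F (x, 0) = f₁ x := by simp [hFdef]
  have key := congrArg (fun T : EuclideanSpace ℝ (Fin 2) × EuclideanSpace ℝ (Fin 2) →L[ℝ] EuclideanSpace ℝ (Fin 2) × EuclideanSpace ℝ (Fin 2) =>
    (T (e, !₂[α, β])).2) hEq
  simp only [ContinuousLinearMap.comp_apply, ContinuousLinearMap.id_apply] at key
  rw [hL₀apply, hF0] at key
  simpa using key

end FriendsCarrierVk

open FriendsCarrierVk in
/-- **Helper `helper_friendsCarrier_Vk_partA_tubeFrameInverse`** (piece of `helper_friendsCarrier_Vk_partA`: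
`DFinv ∘ DF = 1` along the zero section of the affine tube, fibre part).  For the affine tube
`F(x, w) = f₁ x + w₀ m₀ x + w₁ m₁ x` (`f₁, m₀, m₁` of class `C^∞`) with a `C^∞` left inverse `Finv` on the open
image of `B(0, 1 + δ) × B(0, η)`, and `‖x‖ < 1 + δ`: the second component of
`DFinv(f₁ x) (df₁(x) e + α m₀ x + β m₁ x)` is `(α, β)`. [cite: Hirsch1976, Ch. 4 §5] -/
theorem helper_friendsCarrier_Vk_partA_tubeFrameInverse : ∀ (f₁ m₀ m₁ : EuclideanSpace ℝ (Fin 2) → EuclideanSpace ℝ (Fin 4)) (Finv : EuclideanSpace ℝ (Fin 4) → EuclideanSpace ℝ (Fin 2) × EuclideanSpace ℝ (Fin 2)) (δ η : ℝ), 0 < η → ContDiff ℝ ((⊤ : ℕ∞) : WithTop ℕ∞) f₁ → ContDiff ℝ ((⊤ : ℕ∞) : WithTop ℕ∞) m₀ → ContDiff ℝ ((⊤ : ℕ∞) : WithTop ℕ∞) m₁ → IsOpen ((fun q : EuclideanSpace ℝ (Fin 2) × EuclideanSpace ℝ (Fin 2) => f₁ q.1 + q.2 0 • m₀ q.1 +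 q.2 1 • m₁ q.1) '' (Metric.ball (0 : EuclideanSpace ℝ (Fin 2)) (1 + δ) ×ˢ Metric.ball (0 : EuclideanSpace ℝ (Fin 2)) η)) → ContDiffOn ℝ ((⊤ : ℕ∞) : WithTop ℕ∞) Finv ((fun q : EuclideanSpace ℝ (Fin 2) × EuclideanSpace ℝ (Fin 2) => f₁ q.1 + q.2 0 • m₀ q.1 + q.2 1 • m₁ q.1) '' (Metric.ball (0 : EuclideanSpace ℝ (Fin 2)) (1 + δ) ×ˢ Metric.ball (0 : EuclideanSpace ℝ (Fin 2)) η)) → (∀ q ∈ Metric.ball (0 : EuclideanSpace ℝ (Fin 2)) (1 + δ) ×ˢ Metric.ball (0 : EuclideanSpace ℝ (Fin 2)) η, Finv (f₁ q.1 + q.2 0 • m₀ q.1 + q.2 1 • m₁ q.1) = q) → ∀ x ∈ Metric.ball (0 : EuclideanSpace ℝ (Fin 2)) (1 + δ), ∀ (e : EuclideanSpace ℝ (Fin 2)) (α β : ℝ), (fderiv ℝ Finv (f₁ x) (fderiv ℝ f₁ x e + α • m₀ x + β • m₁ x)).2 = !₂[α, β] := by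
  intro f₁ m₀ m₁ Finv δ η hη hfs hm₀ hm₁ hopen hFinvs hleft x hx e α β
  exact fderiv_inv_apply_frame hη hfs hm₀ hm₁ hopen hFinvs hleft hx e α β

end Summit.SmoothPoincare4.SmoothPoincare4.Theorems.DcrGap.MkFriends

end
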